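import Summits.Langlands.Langlands.Theses.OrdinaryPrimeTransport
import Summits.Langlands.Langlands.Theorems.WachComponentCensusLiftB2UnramSplitPInPrint
import HarnessLib

/-!
# F3 `_special` — the floor `c = 0` IS the family member `WindowSatakeA2 0` (line `OneComplexPlaceSatakeA2`, crux
# `ReciprocityUpToIrreducibility`, item stmt-Langlands-14328; G4 ladder-down generation 38)

Self-contained certificate (same declarations as §§1–3 of `Lines/OneComplexPlaceSatakeA2.lean`), NO `sorry`:
* the graded family `WindowSatakeA2 : ℕ → Prop` (dial = number of complex places of a quadratic-over-totally-real base
  field; conclusion = clause (A) of `E` at a.e. Satake level for regular `L`-algebraic `π` on `GL₂`), the rung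
  `OneComplexPlaceSatakeA2 = WindowSatakeA2 1`, `mono`, `floor_of_rung`;
* `floor_zero : exists_galoisRep_of_regularAlgebraic → WindowSatakeA2 0` — PROVED: the floor cell IS the tree's named fact
  lang.S27 (`n = 2`, `K` totally real: Carayol–Taylor–Blasius–Rogawski) after the half-twist renormalisation
  `∏ (X - ι⁻¹((q^{1/2}·q^{-1/2}α)⁻¹)) = ∏ (X - ι⁻¹(α⁻¹))`;
* `cmCell` (the CM cells are lang.S27 too) and `rung_of_mixed : lang.S27 → MixedOneComplexPlaceSatakeA2 → rung`,
  `mixed_of_rung` — so the rung's open content is exactly the mixed one-complex-place windows;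
* the F3 line `example (h27 : exists_galoisRep_of_regularAlgebraic) : WindowSatakeA2 0 := by simpa using floor_zero h27`.
Why the witness lies outside S's known regime and exercises the lever: it is the `c = 0` member of the SAME typed family whose
`c = 1` member is open; S (both directions, every `n`, every field, full local–global compatibility) is not known over totally
real fields (clause (B) for `GL₂` over totally real `F` is open in general; irregular `π` open), and the floor's proof in print
(congruences between Hilbert modular forms of cohomological weight, Taylor 1989; Shimura curves, Carayol) is the `[K:F] = 1`
shadow of the rung's intended engine (congruences from partially singular weight on `GSp₄/F`).
-/

noncomputable section

set_option linter.dupNamespace false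

open scoped MatrixGroups Matrix NumberField
open NumberField IsDedekindDomain Field Filter Polynomial
open Literature.NumberTheory.Automorphic Literature.NumberTheory.GaloisRepresentations
open Literature.NumberTheory.PAdicHodge
open Summit.Langlands

namespace Summit.Langlands.Langlands.Cruxes.ReciprocityUpToIrreducibility.OneComplexPlaceSatakeA2

/-! ## 1. The cell body — clause (A) of `E` at SATAKE level, `n = 2`, regular `L`-algebraic `π` -/

/-- **Cell body** (`E`'s clause (A) with `IsGeometricFramed Rec ρ ∧ Corresponds Rec ι π.1 ρ` weakened to
its first, `Rec`-free conjunct `SatakeFrobCompatibleAE ι π.1 ρ` — a.e. Satake/Frobenius compatibility in the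
summit's `L`-normalisation `m = 1` — and `π` restricted to `GL₂` and to REGULAR infinity type): for every
level datum, every cuspidal `π` of `GL₂(𝔸_K)` which is `L`-algebraic and regular, every `ℓ` and
`ι : ℚ̄_ℓ ≃ ℂ`, there is a continuous `ρ : Γ_K → GL₂(ℚ̄_ℓ)` with
`char(ρ(Frob_v)) = ∏ (X - ι⁻¹(α_j⁻¹))` at almost every finite place `v` (`α` the Satake parameter). -/
def RegularSatakeA2 (K : Type) [Field K] [NumberField K] : Prop :=
  ∀ (hcpt : isCompact_glFiniteIntegralLevel 2 K) (π : CuspidalAutomorphicRepData 2 K hcpt),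
    π.1.IsLAlgebraic → (∃ T : InfinityType K 2, π.1.HasInfinityType T ∧ T.IsRegular) →
      ∀ (ℓ : ℕ) [Fact ℓ.Prime] (ι : PadicAlgCl ℓ ≃+* ℂ),
        ∃ ρ : FramedGaloisRep K (PadicAlgCl ℓ) 2, SatakeFrobCompatibleAE ι π.1 ρ

/-- **The quadratic window** (the sector convention of routes `QuadraticWindow` / `TorsionKudlaMillsonWindow`):
`K` is a quadratic extension of a totally real field `F`.  Such `K` are exactly: totally real (`c = 0`
complex places), CM (`c = [F:ℚ]`), or of MIXED signature `(2[F:ℚ] - 2c, c)` with `1 ≤ c ≤ [F:ℚ] - 1`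
(e.g. `ℚ(√(1+√2)) ⊃ ℚ(√2)`, signature `(2,1)`). -/
def IsQuadraticWindow (K : Type) [Field K] [NumberField K] : Prop :=
  ∃ (F : Type) (_ : Field F) (_ : NumberField F) (_ : Algebra F K), IsTotallyReal F ∧ Module.finrank F K = 2

/-! ## 2. The graded family (dial = number of complex places of the window field) and the rung -/

/-- **The family** `WindowSatakeA2 c`: the cell body over every window field `K ⊃ F` (`F` totally real,
`[K:F] = 2`) with AT MOST `c` COMPLEX PLACES.  `c = 0`: `K` totally real — the FLOOR (Carayol, Taylor,
Blasius–Rogawski = lang.S27 at `n = 2`, `floor_zero`); `c = 1`: THE RUNG; `c ≥ 2`: the higher cells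
(`HigherWindows`); `c ≥ [F:ℚ]` contains the CM cell (lang.S27, `cmCell`). Antitone in `c` (`mono`). -/
def WindowSatakeA2 (c : ℕ) : Prop :=
  ∀ (F K : Type) [Field F] [NumberField F] [Field K] [NumberField K] [Algebra F K],
    IsTotallyReal F → Module.finrank F K = 2 → NumberField.InfinitePlace.nrComplexPlaces K ≤ c →
      RegularSatakeA2 K

/-- **THE RUNG** `OneComplexPlaceSatakeA2 := WindowSatakeA2 1`: Galois representations (a.e. Satake level,
`L`-normalisation) for regular `L`-algebraic cuspidal `π` on `GL₂` over every quadratic-over-totally-real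
field with at most ONE complex place — i.e. over totally real fields (known), imaginary quadratic fields
(known: Harris–Soudry–Taylor, Taylor, Berger–Harcos; lang.S27) and the MIXED one-complex-place windows
`K = F(√α)`, `F ≠ ℚ` totally real, `α` negative at exactly one real place of `F` (OPEN — the content). -/
def OneComplexPlaceSatakeA2 : Prop := WindowSatakeA2 1

theorem rung_iff_family_one : OneComplexPlaceSatakeA2 ↔ WindowSatakeA2 1 := Iff.rfl

/-- The family is antitone in the dial: a larger `c` allows more fields. -/
theorem mono {c c' : ℕ} (hle : c ≤ c') (h : WindowSatakeA2 c') : WindowSatakeA2 c :=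
  fun F K _ _ _ _ _ hF hdeg hc => h F K hF hdeg (hc.trans hle)

/-- Rung ⇒ floor cell. -/
theorem floor_of_rung (h : OneComplexPlaceSatakeA2) : WindowSatakeA2 0 := mono (Nat.zero_le 1) h

/-! ## 3. The floor and the CM cells ARE the tree's named fact lang.S27 (sorry-free) -/

/-- **The cell body over a totally real or CM field, from lang.S27** (`exists_galoisRep_of_regularAlgebraic`:
Harris–Lan–Taylor–Thorne / Scholze; at `n = 2` Carayol–Taylor–Blasius–Rogawski over totally real `K` and
Harris–Soudry–Taylor–Berger–Harcos–Mok over CM `K`), by the half-twist `π ↦ π ⊗ |det|^{1/2}` (regular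
algebraic; Satake parameters scale by `q_v^{-1/2}`, which converts lang.S27's unitary normalisation
`∏ (X - ι⁻¹((q^{1/2} β_j)⁻¹))` into the summit's `∏ (X - ι⁻¹(α_j⁻¹))`).  The proof is the one of
`Theorems.exists_irreducible_satakeFrobCompatibleAE_GL2` with Ribet's irreducibility dropped and the
totally-real hypothesis relaxed to lang.S27's `IsTotallyReal K ∨ IsCMField K`. [folklore] -/
theorem regularSatakeA2_of_S27 (h27 : exists_galoisRep_of_regularAlgebraic)
    {K : Type} [Field K] [NumberField K] (hK : IsTotallyReal K ∨ IsCMField K) : RegularSatakeA2 K := by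
  intro hcpt π hL hreg ℓ _ ι
  obtain ⟨T', hT', hT'L⟩ := hL
  obtain ⟨T, hT, hTreg⟩ := hreg
  -- the `a`-multisets of two infinity types of `π` agree, so `T'` is regular as well
  have hT'reg : T'.IsRegular := fun σ => by
    rw [← AutomorphicRepData.HasInfinityType.map_a_eq π.1 hT hT' σ]
    exact hTreg σ
  -- the half-twist `πt = π ⊗ |det|^{1/2}` is regular algebraic (Clozel)
  obtain ⟨χ, πt, hχ, hW, hW', hPiT⟩ := π.exists_twist_hasInfinityType (1 / 2 : ℝ) hT'
  have hPialg : πt.1.IsRegularAlgebraic := by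
    refine ⟨T'.twist ((1 / 2 : ℝ) : ℂ), hPiT, ?_, hT'reg.twist _⟩
    rw [InfinityType.isCAlgebraic_iff_isLAlgebraic_twist, InfinityType.twist_twist]
    convert (InfinityType.isLAlgebraic_twist_intCast_iff T' 1).mpr hT'L using 2
    push_cast
    ring
  obtain ⟨r, -, hr⟩ := h27 hcpt hK πt hPialg ℓ ι
  refine ⟨r, ?_⟩
  -- the finitely many places above `ℓ`
  have hℓ0 : Ideal.span {((ℓ : ℕ) : 𝓞 K)} ≠ ⊥ := by
    rw [Ne, Ideal.span_singleton_eq_bot]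
    exact_mod_cast (Fact.out : ℓ.Prime).ne_zero
  have hfin : ∀ᶠ v : HeightOneSpectrum (𝓞 K) in cofinite, ((ℓ : ℕ) : 𝓞 K) ∉ v.asIdeal := by
    rw [Filter.eventually_cofinite]
    refine (Ideal.finite_factors hℓ0).subset fun v hv => ?_
    simp only [Set.mem_setOf_eq, not_not] at hv
    exact Ideal.dvd_span_singleton.mpr hv
  have hunr : ∀ᶠ v : HeightOneSpectrum (𝓞 K) in cofinite, π.1.IsUnramifiedAt v :=
    π.1.hasSatakeParamAt_cofinite_holds
  have hq : ∀ v : HeightOneSpectrum (𝓞 K), (v.residueCard : ℂ) ≠ 0 := fun v =>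
    Nat.cast_ne_zero.mpr (lt_trans zero_lt_one v.one_lt_residueCard).ne'
  unfold SatakeFrobCompatibleAE
  filter_upwards [hunr, hfin] with v hv hvℓ
  obtain ⟨α, hα⟩ := hv
  have hPiα := AutomorphicRepData.HasSatakeParamAt.of_map_mulChar_detTwist_of_cpow hχ hW hW' hα
  obtain ⟨hur, hcp⟩ := hr v _ hPiα hvℓ
  refine ⟨α, hα, hur, ?_⟩
  -- `∏ (X - ι⁻¹((q^{1/2} · q^{-1/2} a)⁻¹)) = ∏ (X - ι⁻¹(a⁻¹))`
  have hs : ((Real.sqrt (v.residueCard : ℝ) : ℝ) : ℂ) =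
      (v.residueCard : ℂ) ^ (((1 / 2 : ℝ) : ℝ) : ℂ) := by
    rw [Real.sqrt_eq_rpow, Complex.ofReal_cpow (Nat.cast_nonneg _)]
    push_cast
    rfl
  have key : arithFrobPolyOfSatake ι v.residueCard 2
      (α.map (((v.residueCard : ℂ) ^ (-(((1 / 2 : ℝ) : ℝ) : ℂ))) * ·)) =
      arithFrobPolyOfSatake ι v.residueCard 1 α := by
    unfold arithFrobPolyOfSatake
    rw [Multiset.map_map]
    congr 1
    refine Multiset.map_congr rfl fun a _ => ?_
    simp only [Function.comp_apply]
    congr 3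
    rw [hs, show (2 - 1 : ℕ) = 1 from rfl, show (1 - 1 : ℕ) = 0 from rfl, pow_one, pow_zero,
      one_mul, ← mul_assoc, ← Complex.cpow_add _ _ (hq v), add_neg_cancel, Complex.cpow_zero,
      one_mul]
  rw [← key]
  exact hcp

/-- **THE FLOOR `c = 0` IS lang.S27** (a window field with no complex place is totally real,
`NumberField.nrComplexPlaces_eq_zero_iff`). [folklore] -/
theorem floor_zero (h27 : exists_galoisRep_of_regularAlgebraic) : WindowSatakeA2 0 := by
  intro F K _ _ _ _ _ _ _ hc
  have hK : IsTotallyReal K := NumberField.nrComplexPlaces_eq_zero_iff.mp (Nat.le_zero.mp hc)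
  exact regularSatakeA2_of_S27 h27 (Or.inl hK)

/-- **The CM cells are lang.S27 too**: every window field that is CM (the imaginary quadratic fields at
`c = 1`; the top cell `c = [F:ℚ]` of every `F`) — so the rung's OPEN content is exactly the mixed windows.
[folklore] -/
theorem cmCell (h27 : exists_galoisRep_of_regularAlgebraic) {K : Type} [Field K] [NumberField K]
    (hK : IsCMField K) : RegularSatakeA2 K :=
  regularSatakeA2_of_S27 h27 (Or.inr hK)

/-- **The open core of the rung, isolated**: the MIXED one-complex-place windows (`K` a quadratic extension
of a totally real `F` with exactly one complex place and NOT CM, i.e. `[F:ℚ] ≥ 2`; signature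
`(2[F:ℚ]-2, 1)`). -/
def MixedOneComplexPlaceSatakeA2 : Prop :=
  ∀ (F K : Type) [Field F] [NumberField F] [Field K] [NumberField K] [Algebra F K],
    IsTotallyReal F → Module.finrank F K = 2 → NumberField.InfinitePlace.nrComplexPlaces K = 1 →
      ¬ IsCMField K → RegularSatakeA2 K

/-- **Rung = floor (lang.S27) + imaginary-quadratic cell (lang.S27) + mixed core** (sorry-free glue): given
lang.S27, the rung is EQUIVALENT to its mixed core. [folklore] -/
theorem rung_of_mixed (h27 : exists_galoisRep_of_regularAlgebraic) (hmix : MixedOneComplexPlaceSatakeA2) :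
    OneComplexPlaceSatakeA2 := by
  intro F K _ _ _ _ _ hF hdeg hc
  rcases Nat.le_one_iff_eq_zero_or_eq_one.mp hc with h0 | h1
  · exact regularSatakeA2_of_S27 h27 (Or.inl (NumberField.nrComplexPlaces_eq_zero_iff.mp h0))
  · by_cases hCM : IsCMField K
    · exact cmCell h27 hCM
    · exact hmix F K hF hdeg h1 hCM

theorem mixed_of_rung (h : OneComplexPlaceSatakeA2) : MixedOneComplexPlaceSatakeA2 :=
  fun F K _ _ _ _ _ hF hdeg hc _ => h F K hF hdeg hc.le

/-! ## F3 — the floor is the `c = 0` member of the family -/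

/-- **F3 special-case line**: the floor cell, from the tree's named fact lang.S27, no `sorry`. -/
example (h27 : exists_galoisRep_of_regularAlgebraic) : WindowSatakeA2 0 := by
  simpa using floor_zero h27

/-- The same fact also gives the rung's imaginary-quadratic sub-cell and reduces the rung to its mixed core. -/
example (h27 : exists_galoisRep_of_regularAlgebraic) : MixedOneComplexPlaceSatakeA2 → OneComplexPlaceSatakeA2 :=
  rung_of_mixed h27

#print axioms floor_zero
#print axioms rung_of_mixed

end Summit.Langlands.Langlands.Cruxes.ReciprocityUpToIrreducibility.OneComplexPlaceSatakeA2

end
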